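import Summits.BirchSwinnertonDyer.BirchSwinnertonDyer.Theorems.ManinLocalTwoThreeProductCertsOneThirtyTwoBD
import HarnessLib

/-!
# Level 132, class `132b` (weight 4): product certificates, part E

Cell `bsd-f2-manin`, route `ManinLocalTwoThree`, cruxes C2 `ManinOddAtFour` (stmt-BirchSwinnertonDyer-22967) / C3 `ManinPrimeToThreeAtNine` (stmt-22968); prover seat p2 gen 31;
`--supports` (helper).  WEIGHT-4 BRACKET–STURM for the class `132b` (optimal curve `132b1 = [0, -1, 0, -77, 330]`, `deg φ` too large for a weight-2 presentation):
`x∘φ = A/B` with `A = Σ_p alphaB_p · C_{i_p}·C_{j_p}`, `B = Σ_p betaB_p · C_{i_p}·C_{j_p}` over `78` products of an's `30` basis `η`-quotients of `M₂(Γ₀(132))`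
(exact linear algebra + LLL, seat p2 gen 31; the weight-`20` defect `216[A,B]² − F²(864A³ − 18c₄AB² − c₆B³)B` vanishes mod `q^482`, Sturm bound `480`).
HONEST FRAMING: kernel-checked identities of integer lists / elementary bookkeeping (standard axioms); nothing here proves C2/C3 for any `N`, Manin's conjecture or BSD.
[cite: Sturm1987, Thm. 1] [cite: AgasheRibetStein2006, §§1–2] [cite: Koehler2011, §2.1]
-/

set_option autoImplicit false
-- lint-debt: the directory name repeats the summit name (sibling precedent `ManinLocalTwoThreeManinConstantEightyEight.lean`)
set_option linter.dupNamespace false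

noncomputable section

open Complex
open UpperHalfPlane hiding I
open scoped MatrixGroups ModularForm
open ModularForm CongruenceSubgroup PowerSeries
open Literature.NumberTheory.ModularForms
open Literature.NumberTheory.EllipticCurves Literature.NumberTheory.EllipticCurves.ModularForms

namespace Summit.BirchSwinnertonDyer.BirchSwinnertonDyer.Theorems.ManinLocalTwoThree.LevelOneThirtyTwo

open Summit.BirchSwinnertonDyer.BirchSwinnertonDyer.Theorems.ManinLocalTwoThree.BracketSturm Summit.BirchSwinnertonDyer.BirchSwinnertonDyer.Theorems.ManinLocalTwoThree.PinningKernel Summit.BirchSwinnertonDyer.BirchSwinnertonDyer.Theorems.ManinLocalTwoThree.PinningOneThirtyTwo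
open Literature.NumberTheory.EllipticCurves.Rank1Residual.X11RankOneCertificates (discOf c4Of c6Of)

set_option maxHeartbeats 4000000
set_option maxRecDepth 16384

/-! ## Product certificates `52 … 64` -/

/-- `pTB 52 = tabsDeep 2 * tabsDeep 2` below `482` (kernel `decide`). [folklore] -/
theorem hpTB52 : mulList 482 (tabsDeep 2) (tabsDeep 2) = pTB 52 := by
  decide +kernel

/-- The table `pTB 52` agrees below `482` with the `q`-expansion of the weight-`4` form `C_2·C_2`. [folklore] -/
theorem hGB52 {C : Fin 30 → ModularForm (Gamma0 132) 2}
    (hi : ∀ n < 482, (((tabsDeep 2).getD n 0 : ℤ) : ℂ) = (qExpansion 1 ⇑(C 2)).coeff n)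
    (hj : ∀ n < 482, (((tabsDeep 2).getD n 0 : ℤ) : ℂ) = (qExpansion 1 ⇑(C 2)).coeff n) :
    ∀ n < 482, (((pTB 52).getD n 0 : ℤ) : ℂ) = (qExpansion 1 ⇑((C 2).mul (C 2))).coeff n := by
  rw [← hpTB52]; exact qExpansion_coeff_mul_eq_mulList (C 2) (C 2) hi hj

/-- `pTB 53 = tabsDeep 2 * tabsDeep 3` below `482` (kernel `decide`). [folklore] -/
theorem hpTB53 : mulList 482 (tabsDeep 2) (tabsDeep 3) = pTB 53 := by
  decide +kernel

/-- The table `pTB 53` agrees below `482` with the `q`-expansion of the weight-`4` form `C_2·C_3`. [folklore] -/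
theorem hGB53 {C : Fin 30 → ModularForm (Gamma0 132) 2}
    (hi : ∀ n < 482, (((tabsDeep 2).getD n 0 : ℤ) : ℂ) = (qExpansion 1 ⇑(C 2)).coeff n)
    (hj : ∀ n < 482, (((tabsDeep 3).getD n 0 : ℤ) : ℂ) = (qExpansion 1 ⇑(C 3)).coeff n) :
    ∀ n < 482, (((pTB 53).getD n 0 : ℤ) : ℂ) = (qExpansion 1 ⇑((C 2).mul (C 3))).coeff n := by
  rw [← hpTB53]; exact qExpansion_coeff_mul_eq_mulList (C 2) (C 3) hi hj

/-- `pTB 54 = tabsDeep 2 * tabsDeep 4` below `482` (kernel `decide`). [folklore] -/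
theorem hpTB54 : mulList 482 (tabsDeep 2) (tabsDeep 4) = pTB 54 := by
  decide +kernel

/-- The table `pTB 54` agrees below `482` with the `q`-expansion of the weight-`4` form `C_2·C_4`. [folklore] -/
theorem hGB54 {C : Fin 30 → ModularForm (Gamma0 132) 2}
    (hi : ∀ n < 482, (((tabsDeep 2).getD n 0 : ℤ) : ℂ) = (qExpansion 1 ⇑(C 2)).coeff n)
    (hj : ∀ n < 482, (((tabsDeep 4).getD n 0 : ℤ) : ℂ) = (qExpansion 1 ⇑(C 4)).coeff n) :
    ∀ n < 482, (((pTB 54).getD n 0 : ℤ) : ℂ) = (qExpansion 1 ⇑((C 2).mul (C 4))).coeff n := by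
  rw [← hpTB54]; exact qExpansion_coeff_mul_eq_mulList (C 2) (C 4) hi hj

/-- `pTB 55 = tabsDeep 2 * tabsDeep 5` below `482` (kernel `decide`). [folklore] -/
theorem hpTB55 : mulList 482 (tabsDeep 2) (tabsDeep 5) = pTB 55 := by
  decide +kernel

/-- The table `pTB 55` agrees below `482` with the `q`-expansion of the weight-`4` form `C_2·C_5`. [folklore] -/
theorem hGB55 {C : Fin 30 → ModularForm (Gamma0 132) 2}
    (hi : ∀ n < 482, (((tabsDeep 2).getD n 0 : ℤ) : ℂ) = (qExpansion 1 ⇑(C 2)).coeff n)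
    (hj : ∀ n < 482, (((tabsDeep 5).getD n 0 : ℤ) : ℂ) = (qExpansion 1 ⇑(C 5)).coeff n) :
    ∀ n < 482, (((pTB 55).getD n 0 : ℤ) : ℂ) = (qExpansion 1 ⇑((C 2).mul (C 5))).coeff n := by
  rw [← hpTB55]; exact qExpansion_coeff_mul_eq_mulList (C 2) (C 5) hi hj

/-- `pTB 56 = tabsDeep 2 * tabsDeep 6` below `482` (kernel `decide`). [folklore] -/
theorem hpTB56 : mulList 482 (tabsDeep 2) (tabsDeep 6) = pTB 56 := by
  decide +kernel

/-- The table `pTB 56` agrees below `482` with the `q`-expansion of the weight-`4` form `C_2·C_6`. [folklore] -/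
theorem hGB56 {C : Fin 30 → ModularForm (Gamma0 132) 2}
    (hi : ∀ n < 482, (((tabsDeep 2).getD n 0 : ℤ) : ℂ) = (qExpansion 1 ⇑(C 2)).coeff n)
    (hj : ∀ n < 482, (((tabsDeep 6).getD n 0 : ℤ) : ℂ) = (qExpansion 1 ⇑(C 6)).coeff n) :
    ∀ n < 482, (((pTB 56).getD n 0 : ℤ) : ℂ) = (qExpansion 1 ⇑((C 2).mul (C 6))).coeff n := by
  rw [← hpTB56]; exact qExpansion_coeff_mul_eq_mulList (C 2) (C 6) hi hj

/-- `pTB 57 = tabsDeep 2 * tabsDeep 7` below `482` (kernel `decide`). [folklore] -/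
theorem hpTB57 : mulList 482 (tabsDeep 2) (tabsDeep 7) = pTB 57 := by
  decide +kernel

/-- The table `pTB 57` agrees below `482` with the `q`-expansion of the weight-`4` form `C_2·C_7`. [folklore] -/
theorem hGB57 {C : Fin 30 → ModularForm (Gamma0 132) 2}
    (hi : ∀ n < 482, (((tabsDeep 2).getD n 0 : ℤ) : ℂ) = (qExpansion 1 ⇑(C 2)).coeff n)
    (hj : ∀ n < 482, (((tabsDeep 7).getD n 0 : ℤ) : ℂ) = (qExpansion 1 ⇑(C 7)).coeff n) :
    ∀ n < 482, (((pTB 57).getD n 0 : ℤ) : ℂ) = (qExpansion 1 ⇑((C 2).mul (C 7))).coeff n := by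
  rw [← hpTB57]; exact qExpansion_coeff_mul_eq_mulList (C 2) (C 7) hi hj

/-- `pTB 58 = tabsDeep 2 * tabsDeep 8` below `482` (kernel `decide`). [folklore] -/
theorem hpTB58 : mulList 482 (tabsDeep 2) (tabsDeep 8) = pTB 58 := by
  decide +kernel

/-- The table `pTB 58` agrees below `482` with the `q`-expansion of the weight-`4` form `C_2·C_8`. [folklore] -/
theorem hGB58 {C : Fin 30 → ModularForm (Gamma0 132) 2}
    (hi : ∀ n < 482, (((tabsDeep 2).getD n 0 : ℤ) : ℂ) = (qExpansion 1 ⇑(C 2)).coeff n)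
    (hj : ∀ n < 482, (((tabsDeep 8).getD n 0 : ℤ) : ℂ) = (qExpansion 1 ⇑(C 8)).coeff n) :
    ∀ n < 482, (((pTB 58).getD n 0 : ℤ) : ℂ) = (qExpansion 1 ⇑((C 2).mul (C 8))).coeff n := by
  rw [← hpTB58]; exact qExpansion_coeff_mul_eq_mulList (C 2) (C 8) hi hj

/-- `pTB 59 = tabsDeep 2 * tabsDeep 9` below `482` (kernel `decide`). [folklore] -/
theorem hpTB59 : mulList 482 (tabsDeep 2) (tabsDeep 9) = pTB 59 := by
  decide +kernel

/-- The table `pTB 59` agrees below `482` with the `q`-expansion of the weight-`4` form `C_2·C_9`. [folklore] -/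
theorem hGB59 {C : Fin 30 → ModularForm (Gamma0 132) 2}
    (hi : ∀ n < 482, (((tabsDeep 2).getD n 0 : ℤ) : ℂ) = (qExpansion 1 ⇑(C 2)).coeff n)
    (hj : ∀ n < 482, (((tabsDeep 9).getD n 0 : ℤ) : ℂ) = (qExpansion 1 ⇑(C 9)).coeff n) :
    ∀ n < 482, (((pTB 59).getD n 0 : ℤ) : ℂ) = (qExpansion 1 ⇑((C 2).mul (C 9))).coeff n := by
  rw [← hpTB59]; exact qExpansion_coeff_mul_eq_mulList (C 2) (C 9) hi hj

/-- `pTB 60 = tabsDeep 2 * tabsDeep 10` below `482` (kernel `decide`). [folklore] -/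
theorem hpTB60 : mulList 482 (tabsDeep 2) (tabsDeep 10) = pTB 60 := by
  decide +kernel

/-- The table `pTB 60` agrees below `482` with the `q`-expansion of the weight-`4` form `C_2·C_10`. [folklore] -/
theorem hGB60 {C : Fin 30 → ModularForm (Gamma0 132) 2}
    (hi : ∀ n < 482, (((tabsDeep 2).getD n 0 : ℤ) : ℂ) = (qExpansion 1 ⇑(C 2)).coeff n)
    (hj : ∀ n < 482, (((tabsDeep 10).getD n 0 : ℤ) : ℂ) = (qExpansion 1 ⇑(C 10)).coeff n) :
    ∀ n < 482, (((pTB 60).getD n 0 : ℤ) : ℂ) = (qExpansion 1 ⇑((C 2).mul (C 10))).coeff n := by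
  rw [← hpTB60]; exact qExpansion_coeff_mul_eq_mulList (C 2) (C 10) hi hj

/-- `pTB 61 = tabsDeep 2 * tabsDeep 11` below `482` (kernel `decide`). [folklore] -/
theorem hpTB61 : mulList 482 (tabsDeep 2) (tabsDeep 11) = pTB 61 := by
  decide +kernel

/-- The table `pTB 61` agrees below `482` with the `q`-expansion of the weight-`4` form `C_2·C_11`. [folklore] -/
theorem hGB61 {C : Fin 30 → ModularForm (Gamma0 132) 2}
    (hi : ∀ n < 482, (((tabsDeep 2).getD n 0 : ℤ) : ℂ) = (qExpansion 1 ⇑(C 2)).coeff n)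
    (hj : ∀ n < 482, (((tabsDeep 11).getD n 0 : ℤ) : ℂ) = (qExpansion 1 ⇑(C 11)).coeff n) :
    ∀ n < 482, (((pTB 61).getD n 0 : ℤ) : ℂ) = (qExpansion 1 ⇑((C 2).mul (C 11))).coeff n := by
  rw [← hpTB61]; exact qExpansion_coeff_mul_eq_mulList (C 2) (C 11) hi hj

/-- `pTB 62 = tabsDeep 2 * tabsDeep 12` below `482` (kernel `decide`). [folklore] -/
theorem hpTB62 : mulList 482 (tabsDeep 2) (tabsDeep 12) = pTB 62 := by
  decide +kernel

/-- The table `pTB 62` agrees below `482` with the `q`-expansion of the weight-`4` form `C_2·C_12`. [folklore] -/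
theorem hGB62 {C : Fin 30 → ModularForm (Gamma0 132) 2}
    (hi : ∀ n < 482, (((tabsDeep 2).getD n 0 : ℤ) : ℂ) = (qExpansion 1 ⇑(C 2)).coeff n)
    (hj : ∀ n < 482, (((tabsDeep 12).getD n 0 : ℤ) : ℂ) = (qExpansion 1 ⇑(C 12)).coeff n) :
    ∀ n < 482, (((pTB 62).getD n 0 : ℤ) : ℂ) = (qExpansion 1 ⇑((C 2).mul (C 12))).coeff n := by
  rw [← hpTB62]; exact qExpansion_coeff_mul_eq_mulList (C 2) (C 12) hi hj

/-- `pTB 63 = tabsDeep 2 * tabsDeep 13` below `482` (kernel `decide`). [folklore] -/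
theorem hpTB63 : mulList 482 (tabsDeep 2) (tabsDeep 13) = pTB 63 := by
  decide +kernel

/-- The table `pTB 63` agrees below `482` with the `q`-expansion of the weight-`4` form `C_2·C_13`. [folklore] -/
theorem hGB63 {C : Fin 30 → ModularForm (Gamma0 132) 2}
    (hi : ∀ n < 482, (((tabsDeep 2).getD n 0 : ℤ) : ℂ) = (qExpansion 1 ⇑(C 2)).coeff n)
    (hj : ∀ n < 482, (((tabsDeep 13).getD n 0 : ℤ) : ℂ) = (qExpansion 1 ⇑(C 13)).coeff n) :
    ∀ n < 482, (((pTB 63).getD n 0 : ℤ) : ℂ) = (qExpansion 1 ⇑((C 2).mul (C 13))).coeff n := by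
  rw [← hpTB63]; exact qExpansion_coeff_mul_eq_mulList (C 2) (C 13) hi hj

/-- `pTB 64 = tabsDeep 2 * tabsDeep 14` below `482` (kernel `decide`). [folklore] -/
theorem hpTB64 : mulList 482 (tabsDeep 2) (tabsDeep 14) = pTB 64 := by
  decide +kernel

/-- The table `pTB 64` agrees below `482` with the `q`-expansion of the weight-`4` form `C_2·C_14`. [folklore] -/
theorem hGB64 {C : Fin 30 → ModularForm (Gamma0 132) 2}
    (hi : ∀ n < 482, (((tabsDeep 2).getD n 0 : ℤ) : ℂ) = (qExpansion 1 ⇑(C 2)).coeff n)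
    (hj : ∀ n < 482, (((tabsDeep 14).getD n 0 : ℤ) : ℂ) = (qExpansion 1 ⇑(C 14)).coeff n) :
    ∀ n < 482, (((pTB 64).getD n 0 : ℤ) : ℂ) = (qExpansion 1 ⇑((C 2).mul (C 14))).coeff n := by
  rw [← hpTB64]; exact qExpansion_coeff_mul_eq_mulList (C 2) (C 14) hi hj


end Summit.BirchSwinnertonDyer.BirchSwinnertonDyer.Theorems.ManinLocalTwoThree.LevelOneThirtyTwo

end
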